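import Mathlib.Algebra.Order.Field.Basic
import Mathlib.Algebra.Order.Field.Rat
import Mathlib.Algebra.Order.BigOperators.Group.Finset
import Mathlib.Data.Rat.Cast.Order
import Mathlib.Data.Matrix.Mul
import Mathlib.Tactic.Linarith
import Mathlib.Tactic.Ring
import Literature.Computation.Certificates.LinearProgrammingBox
import HarnessLib

/-!
# Box-LP certificates II: enclosed defect, the readers' `sup` layouts, rational data / real unknowns

Companion of `LinearProgrammingBox.lean` (LP certificates over variable and row boxes:
`dualBound?` = `LB(y)`, weak duality over boxes, Farkas gap, rays, complementary slackness). This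
file adds the three remaining printed / engineering forms of the same bound.

1. **ENCLOSED DEFECT** (the point of Neumaier–Shcherbina 2004 §3 and of the interval `𝐝_j` in
   Keil–Jansson 2006 Thm 2 / Jansson 2004 Thm 2): the multiplier `y` and the boxes are exact, but
   the defect `d = c − Aᵀy` is known only through an enclosure `dlo ≤ d ≤ dhi` — because it was
   evaluated with directed rounding (*"This can be calculated by doing the computation twice,
   once with downward and once with upward rounding, giving two vectors r̲, r̄ such that (8) holds
   rigorously although floating point arithmetic was used. Then cᵀx = (Aᵀλ − r)ᵀx = λᵀAx − rᵀx ∈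
   λᵀ𝐛 − 𝐫ᵀ𝐱 (9) and μ := inf(λᵀ𝐛 − 𝐫ᵀ𝐱) (10) is the desired rigorous lower bound for cᵀx"*,
   author version p. 8, read), or because the problem data `A`, `c` are themselves intervals /
   irrational (Keil–Jansson: *"The input data may be uncertain. We describe these uncertainties by
   considering a family of linear programming problems P, where P ∈ 𝐏"*, p. 2; Thm 2 (3)–(4) with
   interval `𝐝_j`, pp. 3–4, read). `dualBoundEncl?` evaluates the interval product `[dlo, dhi]·
   [lb, ub]` cornerwise; `le_of_dualBoundEncl?_eq_some` is the bound, valid for every data instance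
   whose defect lies in the enclosure (so K–J's family statement is this one applied member by
   member). [cite: NeumaierShcherbina2004, §3 (8)–(10)] [cite: KeilJansson2006, Thm 2 (3)–(4)]
2. **THE READERS' `sup` LAYOUTS**: `dualBoundUpper?_eq` (the `max` branch of
   `certsdp.lp.verify_a.dual_bound`: `UB(y) = c₀ + Σ sup y_i·[lo_i,hi_i] + Σ sup d_j·[lb_j,ub_j]`) and
   `farkasGap?_eq` (`verify_a.farkas_gap` / `verify_b`: `I − S` with `I = Σ inf y_i·[lo_i,hi_i]`,
   `S = Σ sup (Aᵀy)_j·[lb_j,ub_j]`), proved equal to the `min`-form definitions of the companion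
   file. [cite: NeumaierShcherbina2004, §3 (9)–(10), §4 (13)–(14)]
3. **RATIONAL CERTIFICATE, REAL UNKNOWNS**: the reader computes `LB(y)` in exact rational
   arithmetic; `dualBound?_cast` says this IS the bound of the real LP with the same data, giving
   `le_of_dualBound?_eq_some_cast` and `not_feasible_of_farkasGap?_pos_cast` for real vectors `x`
   (N–S: *"In exact arithmetic, 𝐫 = 0, and μ … is again the textbook lower bound"*, p. 8).
   [cite: NeumaierShcherbina2004, §3 (10)]
4. Two kernel-checked toy instances (`decide +kernel`) as usage templates.

NOT HERE: floating-point semantics (how `dlo`, `dhi` are obtained is the reader's business; the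
statement only consumes the enclosure); interval matrices as first-class objects (the enclosure
is stated for the scalar defects, which is all (9)–(10) use). HONEST FRAMING: soundness
statements only; every certified number belongs to the client ledger that instantiates them.
-/

namespace Literature.Computation.Certificates

namespace LP

open Finset Matrix

/-- `osum` commutes with additive maps (negation; the cast `ℚ → ℝ`). Private plumbing. [folklore] -/
private theorem osum_map {ι : Type*} [Fintype ι] {M M' : Type*} [AddCommMonoid M]
    [AddCommMonoid M'] (g : M →+ M') (f : ι → Option M) :
    osum (fun i => (f i).map g) = (osum f).map g := by
  unfold osum
  have hiff : (∀ i, ((f i).map g).isSome) ↔ ∀ i, (f i).isSome := by simp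
  by_cases h : ∀ i, (f i).isSome
  · rw [if_pos (hiff.2 h), if_pos h, Option.map_some, map_sum]
    congr 1
    refine Finset.sum_congr rfl fun i _ => ?_
    obtain ⟨t, ht⟩ := Option.isSome_iff_exists.1 (h i)
    simp [ht]
  · rw [if_neg (mt hiff.1 h), if_neg h, Option.map_none]

variable {K : Type*} [Field K] [LinearOrder K] [IsStrictOrderedRing K]
variable {ι κ : Type*} [Fintype ι] [Fintype κ]

/-! ### §1 The readers' `sup` layouts of `UB(y)` and of the Farkas gap -/

omit [IsStrictOrderedRing K] in
/-- `UB(y)` (defined in the companion file as `−LB(−y)` of the negated objective) unfolded as the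
sum of `supTerm?`s with `d = c − Aᵀy` — literally the `max` branch of
`certsdp.lp.verify_a.dual_bound`: `UB(y) = c₀ + Σ_i sup_{r∈[lo_i,hi_i]} y_i r +
Σ_j sup_{t∈[lb_j,ub_j]} d_j t`. [cite: NeumaierShcherbina2004, §3 (9)–(10)] -/
theorem dualBoundUpper?_eq (c₀ : K) (A : Matrix κ ι K) (lo hi : κ → Option K) (c : ι → K)
    (lb ub : ι → Option K) (y : κ → K) :
    dualBoundUpper? c₀ A lo hi c lb ub y =
      (osum fun i => supTerm? (y i) (lo i) (hi i)).bind fun r =>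
        (osum fun j => supTerm? ((c - y ᵥ* A) j) (lb j) (ub j)).map fun v => c₀ + r + v := by
  unfold dualBoundUpper? dualBound? supTerm?
  have hd : (-c - (-y) ᵥ* A) = fun j => -((c - y ᵥ* A) j) := by
    funext j
    simp [Matrix.neg_vecMul, Pi.sub_apply]
    ring
  have hneg : (fun s : K => -s) = ⇑(-AddMonoidHom.id K) := by
    funext s
    simp
  rw [hd]
  simp only [Pi.neg_apply]
  rw [hneg, osum_map, osum_map]
  cases osum (fun i => infTerm? (-y i) (lo i) (hi i)) with
  | none => rfl
  | some r =>
    cases osum (fun j => infTerm? (-(c - y ᵥ* A) j) (lb j) (ub j)) with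
    | none => rfl
    | some v =>
      simp only [Option.map_some, Option.bind_some, AddMonoidHom.neg_apply,
        AddMonoidHom.id_apply]
      congr 1
      ring

omit [IsStrictOrderedRing K] in
/-- The Farkas gap (defined in the companion file as `LB(y)` of the zero objective) in the
readers' layout: `I − S` with `I = Σ_i inf y_i·[lo_i, hi_i]` and `S = Σ_j sup (Aᵀy)_j·[lb_j, ub_j]`
(`certsdp.lp.verify_a.farkas_gap`; `verify_b`: *"the valid inequality Σ_i y_i (a_i.x) ≥ I …
contradicts (Aᵀy).x ≤ S: I > S"*); Neumaier–Shcherbina's `d = inf(𝐫ᵀ𝐱 − λᵀ𝐛)` (14) with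
`λ = −y`. [cite: NeumaierShcherbina2004, §4 (13)–(14)] -/
theorem farkasGap?_eq (A : Matrix κ ι K) (lo hi : κ → Option K) (lb ub : ι → Option K)
    (y : κ → K) :
    farkasGap? A lo hi lb ub y =
      (osum fun i => infTerm? (y i) (lo i) (hi i)).bind fun I =>
        (osum fun j => supTerm? ((y ᵥ* A) j) (lb j) (ub j)).map fun S => I - S := by
  unfold farkasGap? dualBound? supTerm?
  have hneg : (fun s : K => -s) = ⇑(-AddMonoidHom.id K) := by
    funext s
    simp
  simp only [zero_sub, Pi.neg_apply, zero_add]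
  rw [hneg, osum_map]
  cases osum (fun i => infTerm? (y i) (lo i) (hi i)) with
  | none => rfl
  | some I =>
    cases osum (fun j => infTerm? (-(y ᵥ* A) j) (lb j) (ub j)) with
    | none => rfl
    | some v =>
      simp only [Option.map_some, Option.bind_some, AddMonoidHom.neg_apply,
        AddMonoidHom.id_apply]
      congr 1
      ring

/-! ### §2 Enclosure form: the defect known only through bounds `dlo ≤ d ≤ dhi` -/

omit [Fintype ι] [Fintype κ] in
/-- `min (p·a) (q·a) ≤ d·a` for `p ≤ d ≤ q` (a product is monotone or antitone in one factor).
Private plumbing. [folklore] -/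
private theorem min_mul_mul_le_mul {p q d a : K} (hp : p ≤ d) (hq : d ≤ q) :
    min (p * a) (q * a) ≤ d * a := by
  rcases le_total 0 a with ha | ha
  · exact (min_le_left _ _).trans (mul_le_mul_of_nonneg_right hp ha)
  · exact (min_le_right _ _).trans (mul_le_mul_of_nonpos_right hq ha)

/-- `infTerm2? dlo dhi l u = inf {d·t : dlo ≤ d ≤ dhi, l ≤ t ≤ u}` evaluated cornerwise: if the
enclosure forces `d = 0` (`0 ≤ dlo`, `dhi ≤ 0`) the term is `0` whatever the bounds; else if
`dlo ≥ 0` only the lower endpoint is consulted (`min (dlo·l) (dhi·l)`), if `dhi ≤ 0` only the upper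
one, otherwise both must be present and the four corner products are compared. This is one
coordinate of the interval product `𝐫ᵀ𝐱` in (9)–(10) (with `𝐫 = −[dlo, dhi]`) / of the
interval `𝐝_j` term of Keil–Jansson Thm 2 (3)–(4) with its sign conditions (iii).
[cite: NeumaierShcherbina2004, §3 (8)–(10)] -/
def infTerm2? (dlo dhi : K) (l u : Option K) : Option K :=
  if 0 ≤ dlo ∧ dhi ≤ 0 then some 0
  else if 0 ≤ dlo then l.map (fun a => min (dlo * a) (dhi * a))
  else if dhi ≤ 0 then u.map (fun b => min (dlo * b) (dhi * b))
  else l.bind fun a => u.map fun b => min (min (dlo * a) (dhi * a)) (min (dlo * b) (dhi * b))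

omit [Fintype ι] [Fintype κ] in
/-- The defining inequality of `infTerm2?`: `some s`, `dlo ≤ d ≤ dhi`, `l ≤ r ≤ u` ⇒ `s ≤ d·r`.
[cite: NeumaierShcherbina2004, §3 (8)–(10)] -/
theorem le_mul_of_infTerm2?_eq_some {dlo dhi d r s : K} {l u : Option K}
    (h : infTerm2? dlo dhi l u = some s) (hd : dlo ≤ d) (hd' : d ≤ dhi)
    (hl : ∀ a, l = some a → a ≤ r) (hu : ∀ b, u = some b → r ≤ b) : s ≤ d * r := by
  unfold infTerm2? at h
  split_ifs at h with hzero hlo hhi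
  · cases h
    have : d = 0 := le_antisymm (hd'.trans hzero.2) (hzero.1.trans hd)
    simp [this]
  · obtain ⟨a, hla, rfl⟩ := Option.map_eq_some_iff.1 h
    exact (min_mul_mul_le_mul hd hd').trans
      (mul_le_mul_of_nonneg_left (hl a hla) (hlo.trans hd))
  · obtain ⟨b, hub, rfl⟩ := Option.map_eq_some_iff.1 h
    exact (min_mul_mul_le_mul hd hd').trans
      (mul_le_mul_of_nonpos_left (hu b hub) (hd'.trans hhi))
  · obtain ⟨a, hla, h⟩ := Option.bind_eq_some_iff.1 h
    obtain ⟨b, hub, rfl⟩ := Option.map_eq_some_iff.1 h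
    rcases le_total 0 d with h0 | h0
    · exact (min_le_left _ _).trans ((min_mul_mul_le_mul hd hd').trans
        (mul_le_mul_of_nonneg_left (hl a hla) h0))
    · exact (min_le_right _ _).trans ((min_mul_mul_le_mul hd hd').trans
        (mul_le_mul_of_nonpos_left (hu b hub) h0))

/-- **The dual bound from an ENCLOSED defect**: `LBencl = c₀ + Σ_i inf y_i·[lo_i, hi_i] +
Σ_j inf [dlo_j, dhi_j]·[lb_j, ub_j]` — Neumaier–Shcherbina's `μ = inf(λᵀ𝐛 − 𝐫ᵀ𝐱)` (10) with
`𝐫 = −[dlo, dhi]`, Keil–Jansson's (4) with interval `𝐝_j`. The problem data `A`, `c` do not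
enter: only the enclosure does. [cite: NeumaierShcherbina2004, §3 (8)–(10)]
[cite: KeilJansson2006, Thm 2 (3)–(4)] -/
def dualBoundEncl? (c₀ : K) (lo hi : κ → Option K) (lb ub : ι → Option K) (y : κ → K)
    (dlo dhi : ι → K) : Option K :=
  (osum fun i => infTerm? (y i) (lo i) (hi i)).bind fun r =>
    (osum fun j => infTerm2? (dlo j) (dhi j) (lb j) (ub j)).map fun v => c₀ + r + v

/-- **Weak duality over boxes with an enclosed defect** (Neumaier–Shcherbina (8)–(10);
Keil–Jansson / Jansson 2004 Thm 2 for uncertain data, member by member): if the defect of the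
ACTUAL data satisfies `dlo_j ≤ (c − Aᵀy)_j ≤ dhi_j` for all `j` — e.g. `A`, `c` irrational or
interval-valued and the enclosure obtained by outward rounding — and `LBencl = some L`, then
`L ≤ c·x + c₀` for every feasible `x` of that data. [cite: NeumaierShcherbina2004, §3 (8)–(10)]
[cite: KeilJansson2006, Thm 2] -/
theorem le_of_dualBoundEncl?_eq_some {c₀ : K} {A : Matrix κ ι K} {lo hi : κ → Option K}
    {c : ι → K} {lb ub : ι → Option K} {y : κ → K} {dlo dhi : ι → K} {L : K}
    (h : dualBoundEncl? c₀ lo hi lb ub y dlo dhi = some L)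
    (hd : ∀ j, dlo j ≤ (c - y ᵥ* A) j ∧ (c - y ᵥ* A) j ≤ dhi j) {x : ι → K}
    (hx : InBox lb ub x) (hAx : InBox lo hi (A *ᵥ x)) : L ≤ c ⬝ᵥ x + c₀ := by
  unfold dualBoundEncl? at h
  obtain ⟨r, hr, h⟩ := Option.bind_eq_some_iff.1 h
  obtain ⟨v, hv, rfl⟩ := Option.map_eq_some_iff.1 h
  have h1 : r ≤ ∑ i, y i * (A *ᵥ x) i := le_sum_mul_of_osum_infTerm? hr hAx
  have h2 : v ≤ ∑ j, (c - y ᵥ* A) j * x j :=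
    le_sum_mul_of_osum hv fun j _ ht =>
      le_mul_of_infTerm2?_eq_some ht (hd j).1 (hd j).2 (hx j).1 (hx j).2
  rw [dotProduct_eq_sum_mulVec_add_sum_defect A c y x]
  linarith

omit [IsStrictOrderedRing K] [Fintype ι] [Fintype κ] in
/-- The exact form is the degenerate enclosure `dlo = dhi = d`: then `infTerm2? d d = infTerm? d`
(so `dualBoundEncl?` with the exact defect is `dualBound?`). [cite: NeumaierShcherbina2004, §3 (10)] -/
theorem infTerm2?_self (d : K) (l u : Option K) : infTerm2? d d l u = infTerm? d l u := by
  unfold infTerm2? infTerm?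
  by_cases h0 : d = 0
  · subst h0
    simp
  · by_cases hpos : 0 < d
    · simp [hpos.le, h0, hpos, not_le.2 hpos]
    · have hneg : d < 0 := lt_of_le_of_ne (not_lt.1 hpos) h0
      simp [not_le.2 hneg, hneg.le, h0, hpos]

/-! ### §3 Rational certificate, real unknowns (the reader computes in `ℚ`) -/

section Cast

variable {R : Type*} [Field R] [LinearOrder R] [IsStrictOrderedRing R]

omit [Fintype ι] [Fintype κ] in
/-- `infTerm?` commutes with the cast `ℚ → R` (signs and products are preserved). Private
plumbing. [folklore] -/
private theorem infTerm?_cast (w : ℚ) (l u : Option ℚ) :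
    infTerm? (w : R) (l.map (↑)) (u.map (↑)) = (infTerm? w l u).map ((↑) : ℚ → R) := by
  unfold infTerm?
  by_cases h0 : w = 0
  · simp [h0]
  · have h0' : (w : R) ≠ 0 := by exact_mod_cast h0
    by_cases hpos : 0 < w
    · have hpos' : (0 : R) < w := by exact_mod_cast hpos
      simp only [h0, h0', hpos, hpos', if_false, if_true]
      cases l <;> simp [Rat.cast_mul]
    · have hpos' : ¬ (0 : R) < w := by exact_mod_cast hpos
      simp only [h0, h0', hpos, hpos', if_false]
      cases u <;> simp [Rat.cast_mul]

omit [Fintype ι] in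
/-- The defect commutes with the cast: `((c : R) − (y : R) ᵥ* (A : R))_j = ((c − y ᵥ* A)_j : R)`.
Private plumbing. [folklore] -/
private theorem defect_cast (A : Matrix κ ι ℚ) (c : ι → ℚ) (y : κ → ℚ) (j : ι) :
    ((fun j => (c j : R)) - (fun i => (y i : R)) ᵥ* A.map ((↑) : ℚ → R)) j
      = (((c - y ᵥ* A) j : ℚ) : R) := by
  simp [Matrix.vecMul, dotProduct, Matrix.map_apply, Rat.cast_sum, Rat.cast_mul, Rat.cast_sub]

/-- **`LB(y)` commutes with the cast `ℚ → R`**: the bound the reader computes in exact rational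
arithmetic IS the bound of the real LP with the same (rational) data (*"In exact arithmetic,
𝐫 = 0, and μ … is again the textbook lower bound"*). [cite: NeumaierShcherbina2004, §3 (10)] -/
theorem dualBound?_cast (c₀ : ℚ) (A : Matrix κ ι ℚ) (lo hi : κ → Option ℚ) (c : ι → ℚ)
    (lb ub : ι → Option ℚ) (y : κ → ℚ) :
    dualBound? (c₀ : R) (A.map ((↑) : ℚ → R)) (fun i => (lo i).map (↑)) (fun i => (hi i).map (↑))
        (fun j => (c j : R)) (fun j => (lb j).map (↑)) (fun j => (ub j).map (↑))
        (fun i => (y i : R))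
      = (dualBound? c₀ A lo hi c lb ub y).map ((↑) : ℚ → R) := by
  unfold dualBound?
  have h1 : (fun i => infTerm? (y i : R) ((lo i).map (↑)) ((hi i).map (↑))) =
      fun i => (infTerm? (y i) (lo i) (hi i)).map ((Rat.castHom R : ℚ →+* R) : ℚ →+ R) := by
    funext i
    exact infTerm?_cast (R := R) (y i) (lo i) (hi i)
  have h2 : (fun j => infTerm? (((fun j => (c j : R)) - (fun i => (y i : R)) ᵥ*
        A.map ((↑) : ℚ → R)) j) ((lb j).map (↑)) ((ub j).map (↑))) =
      fun j => (infTerm? ((c - y ᵥ* A) j) (lb j) (ub j)).map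
        ((Rat.castHom R : ℚ →+* R) : ℚ →+ R) := by
    funext j
    rw [defect_cast]
    exact infTerm?_cast (R := R) ((c - y ᵥ* A) j) (lb j) (ub j)
  rw [h1, h2, osum_map, osum_map]
  cases osum (fun i => infTerm? (y i) (lo i) (hi i)) with
  | none => rfl
  | some r =>
    cases osum (fun j => infTerm? ((c - y ᵥ* A) j) (lb j) (ub j)) with
    | none => rfl
    | some v => simp [Rat.cast_add]

/-- **Weak duality over boxes, rational certificate and real unknowns**: `LB(y) = some L`
computed from rational data `(c₀, A, lo, hi, c, lb, ub)` and a rational `y` bounds the objective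
of every REAL vector `x` in the (cast) variable box with (cast) row activities in range:
`(L : R) ≤ Σ_j c_j x_j + c₀` — the sentence a `certsdp.lp.cert/1` lower-bound / `optimal` verdict
certifies about the real LP. [cite: NeumaierShcherbina2004, §3 (9)–(10)]
[cite: KeilJansson2006, Thm 2] -/
theorem le_of_dualBound?_eq_some_cast {c₀ : ℚ} {A : Matrix κ ι ℚ} {lo hi : κ → Option ℚ}
    {c : ι → ℚ} {lb ub : ι → Option ℚ} {y : κ → ℚ} {L : ℚ}
    (h : dualBound? c₀ A lo hi c lb ub y = some L) {x : ι → R}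
    (hx : InBox (fun j => (lb j).map ((↑) : ℚ → R)) (fun j => (ub j).map (↑)) x)
    (hAx : InBox (fun i => (lo i).map ((↑) : ℚ → R)) (fun i => (hi i).map (↑))
      (A.map ((↑) : ℚ → R) *ᵥ x)) :
    (L : R) ≤ (fun j => (c j : R)) ⬝ᵥ x + c₀ := by
  have hc := dualBound?_cast (R := R) c₀ A lo hi c lb ub y
  rw [h, Option.map_some] at hc
  exact le_of_dualBound?_eq_some hc hx hAx

/-- The Farkas gap commutes with the cast `ℚ → R`. [cite: NeumaierShcherbina2004, §4 (14)] -/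
theorem farkasGap?_cast (A : Matrix κ ι ℚ) (lo hi : κ → Option ℚ) (lb ub : ι → Option ℚ)
    (y : κ → ℚ) :
    farkasGap? (A.map ((↑) : ℚ → R)) (fun i => (lo i).map (↑)) (fun i => (hi i).map (↑))
        (fun j => (lb j).map (↑)) (fun j => (ub j).map (↑)) (fun i => (y i : R))
      = (farkasGap? A lo hi lb ub y).map ((↑) : ℚ → R) := by
  have hc := dualBound?_cast (R := R) 0 A lo hi 0 lb ub y
  simp only [Rat.cast_zero, Pi.zero_apply] at hc
  exact hc

/-- **Infeasibility, rational certificate and real unknowns**: a rational `y` with positive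
Farkas gap excludes every REAL point of the (cast) box system.
[cite: NeumaierShcherbina2004, §4 (13)–(14)] -/
theorem not_feasible_of_farkasGap?_pos_cast {A : Matrix κ ι ℚ} {lo hi : κ → Option ℚ}
    {lb ub : ι → Option ℚ} {y : κ → ℚ} {g : ℚ} (h : farkasGap? A lo hi lb ub y = some g)
    (hg : 0 < g) {x : ι → R}
    (hx : InBox (fun j => (lb j).map ((↑) : ℚ → R)) (fun j => (ub j).map (↑)) x)
    (hAx : InBox (fun i => (lo i).map ((↑) : ℚ → R)) (fun i => (hi i).map (↑))
      (A.map ((↑) : ℚ → R) *ᵥ x)) : False := by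
  have hc := farkasGap?_cast (R := R) A lo hi lb ub y
  rw [h, Option.map_some] at hc
  exact not_feasible_of_farkasGap?_pos hc (by exact_mod_cast hg) hx hAx

end Cast

/-! ### §4 Worked examples (kernel-checked; usage templates)

LP 1: `min x₀ + x₁` subject to the range row `1 ≤ x₀ + 2x₁ ≤ 4`, `0 ≤ x₀ ≤ 3`, `0 ≤ x₁` (no upper
bound). Certificate `y = (1/2)`: `d = c − Aᵀy = (1/2, 0)`, `LB(y) = 0 + (1/2)·1 + (1/2)·0 + 0 = 1/2`,
which `x* = (0, 1/2)` attains — `1/2` is the optimal value (reader A's zero gap).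
LP 2: rows `x₀ + x₁ ≥ 3`, variables `x₀, x₁ ∈ [0, 1]`: `y = (1)` gives `I = 3`, `S = 1 + 1 = 2`, Farkas
gap `1 > 0` — infeasible. -/

/-- Example (reader A, `optimal`): the dual bound of LP 1 with `y = (1/2)` is `1/2`. -/
example : dualBound? (0 : ℚ) (!![1, 2] : Matrix (Fin 1) (Fin 2) ℚ) ![some 1] ![some 4] ![1, 1]
    ![some 0, some 0] ![some 3, none] ![1/2] = some (1/2) := by
  decide +kernel

/-- Example (readers A/B, `infeasible`): LP 2, the Farkas gap of `y = (1)` is `1`. -/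
example : farkasGap? (!![1, 1] : Matrix (Fin 1) (Fin 2) ℚ) ![some 3] ![none]
    ![some 0, some 0] ![some 1, some 1] ![1] = some 1 := by
  decide +kernel

/-! ### §5 Reader B's criterion for `max` problems (appended 2026-08-26)

`certsdp.lp` `verify_b` checks complementary slackness for `sense = max` with the cases MIRRORED
(`want_lo = (sign > 0) == lower`): `y_i > 0 ⇒ row i at hi_i`, `y_i < 0 ⇒ at lo_i`, `d_j > 0 ⇒ x_j at
ub_j`, `d_j < 0 ⇒ at lb_j` (`d = c − Aᵀy`). This is literally `ComplSlack` of the negated objective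
and multipliers, hence certifies that `x*` MAXIMISES. -/

/-- `ComplSlackMax A lo hi c lb ub y x` — complementary slackness with finite active bounds for a
`max` problem, the mirrored sign cases of `certsdp.lp` `verify_b` (*"max: mirrored"*): with
`d = c − Aᵀy`, `y_i > 0 ⇒ hi_i = (Ax)_i`, `y_i < 0 ⇒ lo_i = (Ax)_i`, `d_j > 0 ⇒ ub_j = x_j`,
`d_j < 0 ⇒ lb_j = x_j`. [cite: GrivaNashSofer2009, Thm 6.11] -/
def ComplSlackMax (A : Matrix κ ι K) (lo hi : κ → Option K) (c : ι → K) (lb ub : ι → Option K)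
    (y : κ → K) (x : ι → K) : Prop :=
  (∀ i, 0 < y i → hi i = some ((A *ᵥ x) i)) ∧ (∀ i, y i < 0 → lo i = some ((A *ᵥ x) i)) ∧
    (∀ j, 0 < (c - y ᵥ* A) j → ub j = some (x j)) ∧ (∀ j, (c - y ᵥ* A) j < 0 → lb j = some (x j))

/-- The `max` criterion IS the `min` criterion (`ComplSlack`) for the negated objective `−c` and
multipliers `−y` (whose defect is `−d`). [cite: GrivaNashSofer2009, Thm 6.11] -/
theorem complSlackMax_iff (A : Matrix κ ι K) (lo hi : κ → Option K) (c : ι → K)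
    (lb ub : ι → Option K) (y : κ → K) (x : ι → K) :
    ComplSlackMax A lo hi c lb ub y x ↔ ComplSlack A lo hi (-c) lb ub (-y) x := by
  have hd : ∀ j, (-c - (-y) ᵥ* A) j = -((c - y ᵥ* A) j) := by
    intro j
    simp [Matrix.neg_vecMul, Pi.sub_apply]
    ring
  unfold ComplSlackMax ComplSlack
  simp only [hd, Pi.neg_apply, neg_pos, neg_lt_zero]
  constructor
  · rintro ⟨h₁, h₂, h₃, h₄⟩
    exact ⟨h₂, h₁, h₄, h₃⟩
  · rintro ⟨h₁, h₂, h₃, h₄⟩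
    exact ⟨h₂, h₁, h₄, h₃⟩

/-- **Complementary slackness ⇒ optimal, `max` problems** (reader B's `optimal` verdict for
`sense = max`): `ComplSlackMax … y x*` ⇒ `c·x + c₀ ≤ c·x* + c₀` for every feasible `x` (and `x*`,
when feasible, is a maximiser) — from `le_of_complSlack` for `(−c, −y)`.
[cite: GrivaNashSofer2009, Thm 6.11] -/
theorem le_of_complSlackMax {c₀ : K} {A : Matrix κ ι K} {lo hi : κ → Option K} {c : ι → K}
    {lb ub : ι → Option K} {y : κ → K} {xs : ι → K} (hCS : ComplSlackMax A lo hi c lb ub y xs)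
    {x : ι → K} (hx : InBox lb ub x) (hAx : InBox lo hi (A *ᵥ x)) :
    c ⬝ᵥ x + c₀ ≤ c ⬝ᵥ xs + c₀ := by
  have h := le_of_complSlack (c₀ := -c₀) ((complSlackMax_iff A lo hi c lb ub y xs).1 hCS) hx hAx
  rw [neg_dotProduct, neg_dotProduct] at h
  linarith

end LP

end Literature.Computation.Certificates
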